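import Summits.QuantumFields.YangMills.Theorems.BalabanUVNodesN15KingModelHeatKernelFullPropagatorFarZone
import HarnessLib

/-!
# BalabanUVNodes ∕ N15 — THE KING-MODEL RUNG (PART Ϻ-d): ★★★★ THE η-UNIFORM INVERSE-SQUARE LAW FOR KING's FULL `A = 0` PROPAGATOR —
# `L²·|A₀⁻¹(u,v)| ≤ C_full(a,m²)∕(1 + dist(u,v)²)` on the fine four-torus `(ℤ∕LM₀)⁴` for EVERY block size `L ≥ 1` and EVERY volume `M₀ ≥ 1`, `A₀ = L²(−Δ) + m² + aQ^*Q`,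
# `C_full = (34016 + 10∕m²)(1 + 98·C_Δ·S_κ∕m²) + 50·C_Δ(1 + κ_A⁻²)∕m⁴` explicit in `(a, m²)` (`C_Δ = CDelta a 4`, `κ_A = kapA a 4` of King1986.UniformDecay, `S_κ = latticeConst 4 κ_A`)
# (Track A, DAG node N15 = NE2; FAN-OUT v1.1 §N15 s3 «KING-MODEL RUNG … + what the curved case adds»; count-neutral)

HONEST FRAMING.  Count-neutral (cell `pub-ymgap`, seat `pub-ymgap-dag-n15-e` g56; `--supports stmt-QuantumFields-27247 --as helper` = K3ᴬ, KEY MAP v3).  King's `A = 0` one-level comparison model at King's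
scaling `c = L²` ([King1986] (2.13) p.653: fine lattice of spacing `η = L⁻¹` in block units; (4.1)–(4.5) p.670): the FULL fluctuation propagator `A₀⁻¹ = (L²(−Δ)+m²+aQ^*Q)⁻¹ = (fineOp L (cM M₀) a L² m²)⁻¹`
of one renormalization step on the cubic torus `(ℤ∕LM₀)⁴`.  THE NODE (N15 = NE2: the η-RATES of the covariance ∕ background kernels) asks how such kernels scale with the spacing.  What the tree
held for `A₀⁻¹`: (i) PART Ϧ's Combes–Thomas bound `‖(A₀⁻¹)_{xy}‖ ≤ (2∕γ_A)e^{−ctRate·dist∕L}` (King (4.33)∕[Dimock2013] L.29–30 — amplitude `O(1)`, NO power of `η`); (ii) R-b's multi-level power law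
`|G(K,M,m²)(x,y)| ≤ C·(L^K∕r)^{d−1}` with an EXISTENTIAL `C = C(L, a, m₀², d)` (uniform in the number of steps `K`, not in `L`); (iii) PART Ϣ's η-uniform law for the COVARIANCE `G = (L²(−Δ)+m²)⁻¹`
WITHOUT the block term (`L²|G| ≤ (34016+10∕m²)∕(1+dist²)`, Ϣ-j).  THIS FILE closes the gap for the full operator:
* §1 ★★★★ **`king_fullProp_correction_powerLaw`** — for ALL `u, v`, every `L ≥ 1`, every `M₀ ≥ 1`: `L²·|A₀⁻¹(u,v) − G(u,v)| ≤ C_corr(a,m²)∕(1 + dist(u,v)²)`,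
  `C_corr = 98(34016+10∕m²)C_ΔS_κ∕m² + 50C_Δ(1+κ_A⁻²)∕m⁴` (Ϻ-c's near zone `D < 6` and far zone `D ≥ 6` united — the case split is on the BLOCK distance of `β_u ∋ u`, `β_v ∋ v`);
* §2 ★★★★ **`king_fullProp_powerLaw_eta_uniform`** — `L²·|A₀⁻¹(u,v)| ≤ C_full(a,m²)∕(1 + dist(u,v)²)`, `C_full = (34016+10∕m²)(1 + 98C_ΔS_κ∕m²) + 50C_Δ(1+κ_A⁻²)∕m⁴`: THE INVERSE-SQUARE LAW OF THE
  CONTINUUM KERNEL `|x−y|⁻²`, UNIFORMLY IN THE LATTICE SPACING, for King's full one-step propagator — in fine-lattice units the kernel is `O(L⁻²)` on the diagonal (★★★ `king_fullProp_diag_le_eta_uniform`;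
  with Ϯ-c's Loewner order `A₀⁻¹ ⪯ G` and O-c-type lower bounds the diagonal IS of order `L⁻²`) and decays like `dist⁻²` out to the torus scale; ★★★ `king_fullProp_powerLaw_exists` (the `∃ C(a,m²) ∀ L ∀ M₀`
  form, the order of quantifiers displayed); ★★★ `king_fullProp_powerLaw_physical` (fine points `≥ L·d_phys` apart: `L²|A₀⁻¹(u,v)| ≤ C_full∕(L²d_phys²)`, i.e. `|A₀⁻¹(u,v)| = O(η⁴∕d_phys²)` — King's
  (3.63) `(L^jη)^{2−d}`-shape at the scale of the separation, one level, every `η`);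
* §3 ★★★ `king_fullProp_powerLaw_what_the_curved_case_adds` — ONE LINE: at a unitary background `U` the same Woodbury algebra holds with `G ↦ (−L²Δ_U+m²)⁻¹` (Kato-dominated by `G`, Ͱ-b∕Ϣ-i by
  name: `L²‖((−L²Δ_U+m²)⁻¹)_{(u,i),(v,j)}‖ ≤ (34016+10∕m²)∕(1+dist²)` at EVERY unitary `U`, restated here as the conjunct that IS in the tree) and `Δ_eff ↦ Δ_eff(U)` (PART Ϧ `norm_blk_effLapU_le` with the mass
  floor `κ = m²`): the curved full-propagator law is the same books with `n`-dependent constants — NOT typed in this file.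
v1.1 (g56, DOC-ONLY; referee ref-K READ-773 NIT-1 «the §3 theorem's NAME promises more than its conjunction delivers»): the curved full-propagator law IS NOW IN THE TREE — PART Ϻ-g
`king_fullPropU_powerLaw_eta_uniform` (`L²‖(A₀(U)⁻¹)_{uv}‖ ≤ C^U_full(a,m²)∕(1+dist²)` at EVERY unitary `U`, `…HeatKernelCovariantFullPropagatorPowerLaw`) and PART Ϻ-h's one-theorem answer
`king_inverseSquare_what_the_curved_case_adds` (`…HeatKernelInverseSquarePackage`); §3 below keeps its name for importers and is to be read as «the covariance layer at every `U` + the flat full law»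
(its docstring), the full curved statement being Ϻ-g's.  Declarations byte-identical to v1.0.
HONEST SCOPE: King's `A = 0` scalar model; cubic four-torus `(ℤ∕LM₀)⁴`, `d+1 = 4` only (the dimension of PART Ϣ); `c = L²`; crude absolute constants (`34016`, `49∕50∕98`) and the tree's `C_Δ`, `κ_A`
([Dimock2013] L.29–30 as landed in King1986.UniformDecay), `S_κ = (2(1−e^{−κ_A∕4})⁻¹)⁴`; the mass enters through `10∕m²` (zero mode), `1∕m²`, `1∕m⁴` (row sums `Σ_xG(u,x) = 1∕m²`) — NOT uniform as `m → 0`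
(as it must: the massless torus propagator does not exist); NOT Bałaban's `G_k(U)` ∕ (3.42) (multi-level, covariant, `L^{−2k}` prefactors); NOT a node discharge (N15 of record untouched); nothing
continuum ∕ ℝ⁴ ∕ OS ∕ mass gap ∕ Clay.
PRIOR TREE ART (by name): Ϻ-c (`mul_abs_fineOp_inv_sub_lapF_inv_le_far`∕`_near`), Ϣ-j (`king_green_powerLaw_tdistT`, `norm_covLapF_inv_entry_le_powerLaw_tdistT`), Ϣ-i (`norm_covLapF_inv_entry_le_powerLaw_eta_uniform`),
Ϣ-l (`powerLaw_const_div_le_physical`), King1986.Torus (`fineOp`, `lapF`, `CDelta`, `kapA`, `CDelta_pos`, `kapA_pos`, `tdistT`, `tdistT_nonneg`), `Beta.WoodburyFibre.cM`, B4Sect5Proof `latticeConst`.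
Dedup (rg at filing): basename 0 files; needles `king_fullProp_correction_powerLaw|king_fullProp_powerLaw_eta_uniform|king_fullProp_diag_le_eta_uniform|king_fullProp_powerLaw_exists|king_fullProp_powerLaw_physical` 0 tree files;
R-b `Curved.fullProp_powerLaw_unif`∕`fullProp_diag_le_unif` are the multi-level, fixed-`L`, existential-constant statements (different objects and quantifiers) — cited, not restated.  presearch: «uniform inverse
square bound lattice propagator block spin» — the tree's King1986∕Dimock2013 lines give exponential decay with `O(1)` amplitude ([Dimock2013] L.30), [Balaban1983RegularityDecay] Thm (1.10) the `|x−y|^{2−d}` law for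
the multi-level `G_k` with constants depending on `L`; no in-tree or held statement of the one-level law uniform in `L` (queries: corpus «propagator block averaging inverse square uniform lattice spacing», galaxy
«unit lattice propagator|G_k(x,y)|L^{-2k}»; corpus+galaxy) — the present file is a composition of in-tree theorems, no new Literature fact.
Locators: [King1986] C. King, CMP 102 (1986) 649–677: (2.13)–(2.14) p.653, Prop. 3.7 (3.63) p.663, (4.1)–(4.5) p.670, (4.33)–(4.34) p.674, (4.44)–(4.45) p.675; [Balaban1983RegularityDecay] Thm (1.10) p.573,
§5 p.600; [Balaban1985BackgroundPropagators] (3.42) p.397 (NOT asserted); [Dimock2013] App. D Lemmas 29–30.  0 `sorry`, 0 `def`.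
-/

noncomputable section

open Real Finset
open scoped BigOperators

namespace Summit.QuantumFields.YangMills.BalabanUVNodes.N15KingModelRung.HeatKernel

open Literature.MathematicalPhysics.QuantumFieldTheory.Balaban1983to89.B5Prop11Plancherel (Tor fine)
open Literature.MathematicalPhysics.QuantumFieldTheory.Balaban1983to89.Beta.WoodburyFibre (cM)
open Literature.MathematicalPhysics.QuantumFieldTheory.Balaban1983to89 (B4Sect5Proof.latticeConst B4Sect5Proof.latticeConst_nonneg)
open Literature.MathematicalPhysics.QuantumFieldTheory.King1986.Torus
  (lapF fineOp blockOf tdistT tdistT_nonneg CDelta kapA kapA_pos CDelta_pos)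
open Summit.QuantumFields.YangMills.BalabanUVNodes.N15KingModelRung.Covariant (covLapF)

variable (L M₀ : ℕ) [NeZero L] [NeZero M₀] {a m2 : ℝ}

/-! ## §1 The block correction, all pairs -/

omit [NeZero L] [NeZero M₀] in
/-- `C_Δ·S_κ ≥ 0` (`CDelta_pos`, `B4Sect5Proof.latticeConst_nonneg`). [folklore] -/
theorem CDelta_mul_latticeConst_nonneg (ha : 0 < a) : 0 ≤ CDelta a 4 * B4Sect5Proof.latticeConst 4 (kapA a 4) :=
  mul_nonneg (CDelta_pos ha 4).le (B4Sect5Proof.latticeConst_nonneg 4 (kapA_pos ha 4).le)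

/-- ★★★★ **THE BLOCK CORRECTION OF THE FULL PROPAGATOR OBEYS THE INVERSE-SQUARE LAW, UNIFORMLY IN `η`**: for ALL `u, v ∈ (ℤ∕LM₀)⁴`, every `L ≥ 1`, every `M₀ ≥ 1` (`a, m² > 0`),
`L²·|A₀⁻¹(u,v) − G(u,v)| ≤ (98(34016+10∕m²)C_ΔS_κ∕m² + 50C_Δ(1+κ_A⁻²)∕m⁴)∕(1 + dist(u,v)²)` (Ϻ-c's near and far zones united).
[cite: King1986, (2.13)–(2.14) p.653, (4.34) p.674, (4.44)–(4.45) p.675; Dimock2013, App. D Lemma 30; Balaban1983RegularityDecay, §5 p.600] -/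
theorem king_fullProp_correction_powerLaw (ha : 0 < a) (hm : 0 < m2) (u v : Tor (fine L (cM M₀))) :
    (L : ℝ) ^ 2 * |(fineOp L (cM M₀) a ((L : ℝ) ^ 2) m2)⁻¹ u v - (lapF (fine L (cM M₀)) ((L : ℝ) ^ 2) m2)⁻¹ u v|
      ≤ (98 * (34016 + 10 / m2) * (CDelta a 4 * B4Sect5Proof.latticeConst 4 (kapA a 4)) / m2 + 50 * CDelta a 4 * (1 + (kapA a 4 ^ 2)⁻¹) / m2 ^ 2)
          / (1 + tdistT (fine L (cM M₀)) u v ^ 2) := by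
  have hCS := CDelta_mul_latticeConst_nonneg ha
  have hCD := (CDelta_pos ha 4).le
  have hκ2 : 0 < kapA a 4 ^ 2 := pow_pos (kapA_pos ha 4) 2
  have ht : 0 < 1 + tdistT (fine L (cM M₀)) u v ^ 2 := by positivity
  have hC0 : 0 ≤ (34016 + 10 / m2 : ℝ) := by positivity
  -- both zone constants are below the united one
  have hfar_le : (98 * (34016 + 10 / m2) * (CDelta a 4 * B4Sect5Proof.latticeConst 4 (kapA a 4)) / m2 + 50 * CDelta a 4 / (kapA a 4 ^ 2 * m2 ^ 2))
      ≤ 98 * (34016 + 10 / m2) * (CDelta a 4 * B4Sect5Proof.latticeConst 4 (kapA a 4)) / m2 + 50 * CDelta a 4 * (1 + (kapA a 4 ^ 2)⁻¹) / m2 ^ 2 := by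
    have hκ0 : kapA a 4 ^ 2 ≠ 0 := hκ2.ne'
    have hm0 : m2 ^ 2 ≠ 0 := by positivity
    have : 50 * CDelta a 4 / (kapA a 4 ^ 2 * m2 ^ 2) ≤ 50 * CDelta a 4 * (1 + (kapA a 4 ^ 2)⁻¹) / m2 ^ 2 := by
      have e : 50 * CDelta a 4 / (kapA a 4 ^ 2 * m2 ^ 2) = 50 * CDelta a 4 * (kapA a 4 ^ 2)⁻¹ / m2 ^ 2 := by
        field_simp
      rw [e]
      refine div_le_div_of_nonneg_right (mul_le_mul_of_nonneg_left ?_ (by positivity)) (by positivity)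
      linarith
    linarith
  have hnear_le : 50 * CDelta a 4 / m2 ^ 2
      ≤ 98 * (34016 + 10 / m2) * (CDelta a 4 * B4Sect5Proof.latticeConst 4 (kapA a 4)) / m2 + 50 * CDelta a 4 * (1 + (kapA a 4 ^ 2)⁻¹) / m2 ^ 2 := by
    have h1 : 0 ≤ 98 * (34016 + 10 / m2) * (CDelta a 4 * B4Sect5Proof.latticeConst 4 (kapA a 4)) / m2 := by positivity
    have h2 : 50 * CDelta a 4 / m2 ^ 2 ≤ 50 * CDelta a 4 * (1 + (kapA a 4 ^ 2)⁻¹) / m2 ^ 2 := by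
      refine div_le_div_of_nonneg_right ?_ (by positivity)
      exact le_mul_of_one_le_right (by positivity) (by linarith [inv_nonneg.mpr hκ2.le])
    linarith
  rcases lt_or_ge (tdistT (cM M₀) (blockOf L (cM M₀) u) (blockOf L (cM M₀) v)) 6 with hD | hD
  · exact (mul_abs_fineOp_inv_sub_lapF_inv_le_near L M₀ ha hm u v hD).trans (div_le_div_of_nonneg_right hnear_le ht.le)
  · exact (mul_abs_fineOp_inv_sub_lapF_inv_le_far L M₀ ha hm u v hD).trans (div_le_div_of_nonneg_right hfar_le ht.le)

/-! ## §2 ★★★★ The inverse-square law for the full propagator -/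

/-- ★★★★ **THE η-UNIFORM INVERSE-SQUARE LAW FOR KING's FULL `A = 0` PROPAGATOR**: for ALL `u, v ∈ (ℤ∕LM₀)⁴`, EVERY block size `L ≥ 1`, EVERY volume `M₀ ≥ 1` (`a, m² > 0`),
`L²·|(L²(−Δ)+m²+aQ^*Q)⁻¹(u,v)| ≤ C_full(a,m²)∕(1 + dist(u,v)²)` with `C_full = (34016+10∕m²)(1 + 98C_ΔS_κ∕m²) + 50C_Δ(1+κ_A⁻²)∕m⁴` — the continuum kernel's `|x−y|⁻²` singularity, uniformly in the lattice
spacing `η = 1∕L`, for the full one-step fluctuation propagator (PART Ϣ-j for `G` plus §1 for the block correction).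
[cite: King1986, (2.13)–(2.14) p.653, (3.63) p.663, (4.33)–(4.34) p.674, (4.44)–(4.45) p.675; Balaban1983RegularityDecay, Thm (1.10) p.573; Dimock2013, App. D Lemmas 29–30] -/
theorem king_fullProp_powerLaw_eta_uniform (ha : 0 < a) (hm : 0 < m2) (u v : Tor (fine L (cM M₀))) :
    (L : ℝ) ^ 2 * |(fineOp L (cM M₀) a ((L : ℝ) ^ 2) m2)⁻¹ u v|
      ≤ ((34016 + 10 / m2) * (1 + 98 * (CDelta a 4 * B4Sect5Proof.latticeConst 4 (kapA a 4)) / m2) + 50 * CDelta a 4 * (1 + (kapA a 4 ^ 2)⁻¹) / m2 ^ 2)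
          / (1 + tdistT (fine L (cM M₀)) u v ^ 2) := by
  have hG := king_green_powerLaw_tdistT L M₀ hm u v
  have hT := king_fullProp_correction_powerLaw L M₀ ha hm u v
  have hL2 : (0 : ℝ) ≤ (L : ℝ) ^ 2 := by positivity
  have htri : |(fineOp L (cM M₀) a ((L : ℝ) ^ 2) m2)⁻¹ u v|
      ≤ |(lapF (fine L (cM M₀)) ((L : ℝ) ^ 2) m2)⁻¹ u v| + |(fineOp L (cM M₀) a ((L : ℝ) ^ 2) m2)⁻¹ u v - (lapF (fine L (cM M₀)) ((L : ℝ) ^ 2) m2)⁻¹ u v| := by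
    have := abs_add_le ((lapF (fine L (cM M₀)) ((L : ℝ) ^ 2) m2)⁻¹ u v) ((fineOp L (cM M₀) a ((L : ℝ) ^ 2) m2)⁻¹ u v - (lapF (fine L (cM M₀)) ((L : ℝ) ^ 2) m2)⁻¹ u v)
    rwa [add_sub_cancel] at this
  calc (L : ℝ) ^ 2 * |(fineOp L (cM M₀) a ((L : ℝ) ^ 2) m2)⁻¹ u v|
      ≤ (L : ℝ) ^ 2 * |(lapF (fine L (cM M₀)) ((L : ℝ) ^ 2) m2)⁻¹ u v|
          + (L : ℝ) ^ 2 * |(fineOp L (cM M₀) a ((L : ℝ) ^ 2) m2)⁻¹ u v - (lapF (fine L (cM M₀)) ((L : ℝ) ^ 2) m2)⁻¹ u v| := by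
        rw [← mul_add]; exact mul_le_mul_of_nonneg_left htri hL2
    _ ≤ (34016 + 10 / m2) / (1 + tdistT (fine L (cM M₀)) u v ^ 2)
          + (98 * (34016 + 10 / m2) * (CDelta a 4 * B4Sect5Proof.latticeConst 4 (kapA a 4)) / m2 + 50 * CDelta a 4 * (1 + (kapA a 4 ^ 2)⁻¹) / m2 ^ 2)
              / (1 + tdistT (fine L (cM M₀)) u v ^ 2) := add_le_add hG hT
    _ = _ := by rw [← add_div]; congr 1; ring

/-- ★★★ **THE DIAGONAL SCALE**: `L²·|A₀⁻¹(u,v)| ≤ C_full(a,m²)` for all `u, v` — in particular the diagonal of the full propagator is `O(L⁻²) = O(η²)` uniformly (the `j = 0` exponent of King's (3.63) at one level).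
[cite: King1986, (2.13) p.653, (3.63) p.663, (4.33) p.674] -/
theorem king_fullProp_diag_le_eta_uniform (ha : 0 < a) (hm : 0 < m2) (u v : Tor (fine L (cM M₀))) :
    (L : ℝ) ^ 2 * |(fineOp L (cM M₀) a ((L : ℝ) ^ 2) m2)⁻¹ u v|
      ≤ (34016 + 10 / m2) * (1 + 98 * (CDelta a 4 * B4Sect5Proof.latticeConst 4 (kapA a 4)) / m2) + 50 * CDelta a 4 * (1 + (kapA a 4 ^ 2)⁻¹) / m2 ^ 2 := by
  have h := king_fullProp_powerLaw_eta_uniform L M₀ ha hm u v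
  have hCS := CDelta_mul_latticeConst_nonneg ha
  have hCD := (CDelta_pos ha 4).le
  have hκ2 : 0 ≤ (kapA a 4 ^ 2)⁻¹ := inv_nonneg.mpr (pow_pos (kapA_pos ha 4) 2).le
  have hC : 0 ≤ (34016 + 10 / m2) * (1 + 98 * (CDelta a 4 * B4Sect5Proof.latticeConst 4 (kapA a 4)) / m2) + 50 * CDelta a 4 * (1 + (kapA a 4 ^ 2)⁻¹) / m2 ^ 2 := by positivity
  refine h.trans (div_le_self hC ?_)
  nlinarith [tdistT_nonneg (fine L (cM M₀)) u v]

/-- ★★★ **THE ORDER OF QUANTIFIERS**: there is ONE constant `C = C(a,m²) > 0` such that for EVERY `L ≥ 1`, EVERY `M₀ ≥ 1` and all `u, v ∈ (ℤ∕LM₀)⁴`, `L²|A₀⁻¹(u,v)| ≤ C∕(1+dist(u,v)²)`.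
[cite: King1986, (2.13)–(2.14) p.653, (3.63) p.663; Balaban1983RegularityDecay, Thm (1.10) p.573] -/
theorem king_fullProp_powerLaw_exists (ha : 0 < a) (hm : 0 < m2) :
    ∃ C : ℝ, 0 < C ∧ ∀ (L M₀ : ℕ) [NeZero L] [NeZero M₀] (u v : Tor (fine L (cM M₀))),
      (L : ℝ) ^ 2 * |(fineOp L (cM M₀) a ((L : ℝ) ^ 2) m2)⁻¹ u v| ≤ C / (1 + tdistT (fine L (cM M₀)) u v ^ 2) := by
  refine ⟨(34016 + 10 / m2) * (1 + 98 * (CDelta a 4 * B4Sect5Proof.latticeConst 4 (kapA a 4)) / m2) + 50 * CDelta a 4 * (1 + (kapA a 4 ^ 2)⁻¹) / m2 ^ 2, ?_,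
    fun L M₀ _ _ u v => king_fullProp_powerLaw_eta_uniform L M₀ ha hm u v⟩
  have hCS := CDelta_mul_latticeConst_nonneg ha
  have hCD := CDelta_pos ha 4
  have hκ2 : 0 ≤ (kapA a 4 ^ 2)⁻¹ := inv_nonneg.mpr (pow_pos (kapA_pos ha 4) 2).le
  positivity

/-- ★★★ **IN PHYSICAL UNITS**: fine points at lattice distance `≥ L·d_phys` (`d_phys > 0` blocks) satisfy `L²|A₀⁻¹(u,v)| ≤ C_full(a,m²)∕(L²·d_phys²)`, i.e. `|A₀⁻¹(u,v)| ≤ C_full·L⁻⁴∕d_phys²` —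
King's (3.63) shape `(L^jη)^{2−d}` (`d = 4`) at the scale of the separation, for every `η = L⁻¹`. [cite: King1986, (3.63) p.663, (2.13) p.653] -/
theorem king_fullProp_powerLaw_physical (ha : 0 < a) (hm : 0 < m2) (u v : Tor (fine L (cM M₀))) {dphys : ℝ} (hd : 0 < dphys)
    (hsep : (L : ℝ) * dphys ≤ tdistT (fine L (cM M₀)) u v) :
    (L : ℝ) ^ 2 * |(fineOp L (cM M₀) a ((L : ℝ) ^ 2) m2)⁻¹ u v|
      ≤ ((34016 + 10 / m2) * (1 + 98 * (CDelta a 4 * B4Sect5Proof.latticeConst 4 (kapA a 4)) / m2) + 50 * CDelta a 4 * (1 + (kapA a 4 ^ 2)⁻¹) / m2 ^ 2)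
          / ((L : ℝ) ^ 2 * dphys ^ 2) := by
  have h := king_fullProp_powerLaw_eta_uniform L M₀ ha hm u v
  have hCS := CDelta_mul_latticeConst_nonneg ha
  have hCD := (CDelta_pos ha 4).le
  have hκ2 : 0 ≤ (kapA a 4 ^ 2)⁻¹ := inv_nonneg.mpr (pow_pos (kapA_pos ha 4) 2).le
  have hC : 0 ≤ (34016 + 10 / m2) * (1 + 98 * (CDelta a 4 * B4Sect5Proof.latticeConst 4 (kapA a 4)) / m2) + 50 * CDelta a 4 * (1 + (kapA a 4 ^ 2)⁻¹) / m2 ^ 2 := by positivity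
  have hL0 : (0 : ℝ) < L := by exact_mod_cast Nat.pos_of_ne_zero (NeZero.ne L)
  have hLd : 0 < (L : ℝ) * dphys := by positivity
  have hsq : ((L : ℝ) * dphys) ^ 2 ≤ tdistT (fine L (cM M₀)) u v ^ 2 := pow_le_pow_left₀ hLd.le hsep 2
  refine h.trans (div_le_div_of_nonneg_left hC (by positivity) ?_)
  nlinarith

/-! ## §3 What the curved case adds -/

/-- ★★★ **WHAT THE CURVED CASE ADDS, BY NAME**: the covariance layer of the law holds at EVERY unitary link field already — Ϣ-j∕Ϣ-i (Kato domination): for every unitary `U` on the fine four-torus and all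
fibre indices, `L²·‖((−L²Δ_U+m²)⁻¹)_{(u,i),(v,j)}‖ ≤ (34016+10∕m²)∕(1+dist(u,v)²)`; the block-correction layer at curved `U` is the same Woodbury algebra with `Δ_eff(U)` (PART Ϧ, mass floor) — not typed
here (v1.1: it is PART Ϻ-g `king_fullPropU_powerLaw_eta_uniform`; this conjunction = the covariance layer at every `U` + the flat full law §2); at `U ≡ 1` §2 is the full statement.
[cite: Balaban1985BackgroundPropagators, (3.23) p.394, Thm 3.4 p.400; King1986, (2.13) p.653] -/
theorem king_fullProp_powerLaw_what_the_curved_case_adds (ha : 0 < a) (hm : 0 < m2) {𝕜 : Type*} [RCLike 𝕜] {n : Type*} [Fintype n] [DecidableEq n]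
    {U : Tor (fine L (cM M₀)) × Fin 4 → Matrix n n 𝕜} (hU : ∀ b, U b ∈ Matrix.unitaryGroup n 𝕜) (u v : Tor (fine L (cM M₀))) (i j : n) :
    (L : ℝ) ^ 2 * ‖(covLapF (fine L (cM M₀)) ((L : ℝ) ^ 2) m2 U)⁻¹ (u, i) (v, j)‖ ≤ (34016 + 10 / m2) / (1 + tdistT (fine L (cM M₀)) u v ^ 2)
      ∧ (L : ℝ) ^ 2 * |(fineOp L (cM M₀) a ((L : ℝ) ^ 2) m2)⁻¹ u v|
          ≤ ((34016 + 10 / m2) * (1 + 98 * (CDelta a 4 * B4Sect5Proof.latticeConst 4 (kapA a 4)) / m2) + 50 * CDelta a 4 * (1 + (kapA a 4 ^ 2)⁻¹) / m2 ^ 2)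
              / (1 + tdistT (fine L (cM M₀)) u v ^ 2) := by
  refine ⟨?_, king_fullProp_powerLaw_eta_uniform L M₀ ha hm u v⟩
  obtain ⟨ν, hν⟩ := exists_tdistT_eq_natAbs_valMinAbs (fine L (cM M₀)) u v
  rw [hν]
  exact norm_covLapF_inv_entry_le_powerLaw_eta_uniform L M₀ hm hU u v i j ν

end Summit.QuantumFields.YangMills.BalabanUVNodes.N15KingModelRung.HeatKernel

end
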